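import Mathlib
import HarnessLib
import HarnessLib.Audit
import Summits.RiemannHypothesis.Statement
import Summits.RiemannHypothesis.RiemannHypothesis.Theorems.LiCoefficientsDefs
import Literature.NumberTheory.LFunctions.NymanBeurlingProofs
import Literature.NumberTheory.LFunctions.NymanBeurlingRate
import Summits.RiemannHypothesis.RiemannHypothesis.Theorems.NymanBeurlingTailLeaf
import HarnessLib.Audit.Status.Attr

/-!
Route: NymanBeurlingTail

CLOSED (proved) 2026-08-26T11:47:28Z by operator:999:2546756 — reason: proved:Summit.RiemannHypothesis.RiemannHypothesis.Theorems.NbTheory.nbTailConstIdentity_holds — note: PROVED close: rung L-P(P2) Nyman–Beurling tail constant identity; items 19682–19686 closed·proved; leaf p409255 (director-rh g5 11:17:38Z). The file is kept as the record of this route; refuted decls are indexed as negative knowledge (`ledger negatives`).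

# Route NymanBeurlingTail — Nyman–Beurling minimiser, RH-free per N; the tail constant Σ c_k/(k+1)
is the h-component of χ − f⋆ over 1 + Var

Column LI/NB of the RH ladder, rung L-P(P2) (D-0040/D-0059(a)/D-0061): the STRUCTURE of the
Báez-Duarte minimiser
`c⋆_N = G⁻¹b` of `‖χ − Σ_{k<N} c_k ρ_{k+1}‖_{L²(0,∞)}` is RH-FREE for every fixed `N`. The rung LEAF
is the TAIL-CONSTANT
IDENTITY `NbTailConstIdentity`: for every `N ≥ 1` and every solution of the normal equations `G c =
b`,
`(1 + Q)·tailConst(c) = (1 − γ) − Σ_k c_k ⟨ρ_{k+1}, h⟩`, where `h = E[{1/x} | I_n]` is the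
conditional expectation of
`{1/x}` on the Farey-type partition `I_n = (1/(n+1), 1/n]` of `(0,1]`, `q = {1/x} − h` and `Q = ‖q‖²
= 0.0803…`
(it explains the measured `κ_N = tailConst/d_N² = 0.3412`, zeroth order `m_1/(1+Q) = 0.3576`,
TARGETS §8.2). It
suffices to show X = NbKeyOrthogonality ∧ NbFirstNormalEquation (+ two routine supports): the first
normal equation
read on Nyman's interval gives `∫_0^1 (χ − f_c){1/x} = tailConst(c)`, and `{1/x} = h + q` with `q ⊥
steps`,
`⟨ρ_{k+1}, q⟩ = Q/(k+1)` turns it into the identity.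
Lean: `Summit.RiemannHypothesis.RiemannHypothesis.Theorems.NbTheory.NbTailConstIdentity`

## Assembly
`closes (h2 : NbKeyOrthogonality) (h3 : NbFirstNormalEquation) (h4 : NbFluctStepOrthogonal) (h5 :
NbCondExpIntegral) (hA : Assembly) : Theorems.NbTheory.NbTailConstIdentity := hA h2 h3 h4 h5`
(glue-nb.lean). The Assembly item is PROVABLE NOW — `assembly_proof` in
HOME/theory/route/nb/SketchNB.lean (farm rc 0 / 0 sorries): on `(0,1]`, `(χ − f_c){1/x} = (1 − Σ c_k
ρ_{k+1})(h + q)`; integrate (all four products bounded measurable): `tailConst = (1−γ) + 0 − Σ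
c_k⟨ρ_{k+1},h⟩ − Q·tailConst`. Under D-0061 (R5) the conclusion is the registered rung leaf («closes
rung L-P(P2) of RiemannHypothesis», never summit credit).

CLOSES_TARGET: closes rung L-P(P2) of RiemannHypothesis: Summit.RiemannHypothesis.RiemannHypothesis.Theorems.NbTheory.NbTailConstIdentity (D-0061; not the summit Statement) — the deciding theorem of this route concludes that registered leaf instead of the Statement decl `RiemannHypothesis` (class rung: servable and labelled, never counted as concluding the summit Statement).

Rationale: WHY THIS LINE. The door of the column is Báez-Duarte's criterion `RH ↔ d_N → 0` (tree
`baezDuarte_iff_holds`; RH-EQUIVALENT, route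
NymanBeurling, not claimed here). What is RH-free is the finite-`N` least-squares problem: its Gram
matrix is explicit
(Vasyunin1996; LandreauRichard2002 Thm 2.1; BDBLS2000) and on `(1,∞)` every competitor is
`−tailConst(c)/x`
(BaezDuarte2003 §2.2, tree `approx_eq_of_one_lt`, `integral_Ioi_one_sq_approx`). The imported idea
is the
probabilist's conditional-expectation split `{1/x} = h + q` on the partition `{I_n}` (q has mean
zero on every `I_n`),
combined with Báez-Duarte's observation that `ρ_{k+1} − ρ_1/(k+1)` is an `I_n`-step function
(BaezDuarte2000, the class
`𝒞^nat` of Prop. 4.7, tree docstring of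
`Literature.Barriers.RiemannHypothesis.NymanBeurlingObstructions`): hence
`⟨ρ_{k+1}, q⟩ = ⟨ρ_1, q⟩/(k+1) = Q/(k+1)` for EVERY k — the dilates see the fluctuation `q` only
through the tail
weights `1/(k+1)`. Reading the `k = 0` normal equation on `(0,1]` then gives the leaf in three lines
(Assembly PROVED,
HOME/theory/route/nb/SketchNB.lean). Certified numerically to 2·10⁻¹² for all `N ≤ 2000` (kit
j243603, rh-li-eng Gram
lineage); nothing in the negatives index concerns NB minimisers.

RANKED CRUXES. #2 NbKeyOrthogonality (crux) — (K1) KEY ORTHOGONALITY: for every `k ≥ 0`, `∫_{(0,1]}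
ρ_{k+1}(x) q(x) dx = Q/(k+1)` with `ρ_{k+1}(x) = {1/((k+1)x)}`, `q = {1/x} − h`, `Q = ∫_{(0,1]} q²`
— because `ρ_{k+1} = ρ_1/(k+1) + {⌊1/x⌋/(k+1)}` on `(0,1]` (an `I_n`-step function), `q ⊥` bounded
steps, and `⟨ρ_1, q⟩ = ⟨h + q, q⟩ = Q`. [deps: NbFluctStepOrthogonal] [difficulty: M] (why it might
fail: derived this week, float-checked only (k+1 = 1,2,3,5 to 1e-9, g3 ortho_check.py; (T3) to 2e-12
for N ≤ 2000, j243603); false iff the step-function claim ρ_{k+1} − ρ_1/(k+1) ∈ span{1_{I_n}} failed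
on positive measure — a standard floor identity, so the live risk is a convention slip in
nbFluct/nbQ.) [BaezDuarte2000, BaezDuarte2003, Vasyunin1996, folder:ortho_check.py, kit:j243603]
#3 NbFirstNormalEquation (crux) — (K2) the FIRST normal equation on Nyman's interval: if `c` solves
`G c = b` (`N ≥ 1`) then `∫_{(0,1]} (χ − f_c)(x)·{1/x} dx = tailConst(c)` — row `0` of `G` splits as
`G_{0j} = G⁰_{0j} + 1/(j+1)` (on `(1,∞)`, `ρ_1 = 1/x`, `ρ_{j+1} = 1/((j+1)x)`), so `⟨χ − f_c,
ρ_1⟩_{(0,∞)} = 0` reads `⟨χ − f_c, ρ_1⟩_{(0,1]} − tailConst(c) = 0`. [difficulty: M] (why it might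
fail: only if `nbGram 0 j = ∫_{(0,∞)} ρ_1 ρ_{j+1}` were a junk Bochner value (non-integrable
integrand) — it is not: the integrand is ≤ 1 on (0,1] and = 1/((j+1)x²) on (1,∞); a wrong
normalisation of `nbRhs`/`nbGram` (e.g. Gram on (0,1) instead of (0,∞)) would shift the identity by
exactly tailConst.) [BaezDuarte2003, LandreauRichard2002, Vasyunin1996]
#9 NbFluctStepOrthogonal (support) — (K3) `q = {1/x} − h` is orthogonal on `(0,1]` to every bounded
`I_n`-step function `w(⌊1/x⌋)` (mean zero of `q` on each `I_n` by the definition of `m_n =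
n(n+1)log(1+1/n) − n`, summed over the countable partition with `|q| ≤ 2`). [difficulty: M] (why it
might fail: routine (dominated exchange of Σ_n and ∫ over the partition; `∫_{I_n} {1/x} dx =
log(1+1/n) − 1/(n+1) = m_n |I_n|`).) [BaezDuarte2000, folklore]
#9 NbCondExpIntegral (support) — (K4) `∫_{(0,1]} h = Σ_n m_n |I_n| = Σ_n (log(1+1/n) − 1/(n+1)) = 1
− γ` (= `∫_0^1 {1/x} dx`, de la Vallée Poussin). [difficulty: S] (why it might fail: routine
(telescoping `log(N+1) − H_{N+1} + 1 → 1 − γ` against Mathlib's `Real.eulerMascheroniConstant` as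
the limit of `H_n − log n`).) [folklore, Mathlib:Real.tendsto_harmonic_sub_log]

TWO-LAYER PLAN. Birth skeletons checked in HOME/theory/route/nb/BirthNB.lean (farm rc 0, sorries = 5
= stubs; `#h21_check_skeleton` 2/2 ok): NbKeyOrthogonality ⇐ stub_dilateFract (ρ_{k+1} = ρ_1/(k+1) +
{⌊1/x⌋/(k+1)} on (0,1]) → stub_rho1Fluct (⟨ρ_1,q⟩ = Q) → stub_stepFluct (⟨{⌊1/x⌋/(k+1)}, q⟩ = 0) —
composition PROVED; NbFirstNormalEquation ⇐ stub_gramRowZero (G_{0j} = G⁰_{0j} + 1/(j+1)) →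
stub_intervalExpand (linearity on (0,1]) — composition PROVED with the k = 0 normal equation.
Registered as `Cruxes/<Crux>/Lines/birth.lean` after birth.

KILL CRITERIA. A certified ball evaluation of (1+Q)·tailConst(c⋆_N) − [(1−γ) − Σ c⋆_k⟨ρ_{k+1},h⟩]
excluding 0 for some N (rh-li-eng lineage A; currently |·| ≤ 2·10⁻¹² for all N ≤ 2000) refutes the
LEAF and closes the route `refuted`; a refutation of K1 for a single k (float first: ortho_check.py)
kills the line (the leaf might survive with another decomposition of ⟨f_c, q⟩). Proved elsewhere
that moots it: none known.

NOT DECOMPOSED YET. The measure-theoretic lemmas (integrability of the bounded step/fractional-part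
products on (0,1], the partition exchange) live inside the stubs and the Assembly proof, not as
items; the κ-law consequences (T4 zeroth order, L5/T7 prime-side κ_∞ = 0.3398, T2 Sherman–Morrison
head/tail, T6/L8 Levinson) are PROOF-OF-DATA memos (TARGETS §8.2), not items of this route.

CHEAPEST FALSIFIER. Float quadrature of K1 at k+1 = 2: ∫_0^1 {1/(2x)} q(x) dx vs Q/2 = 0.040164
(theory g3 ortho_check.py: agreement 1e-9 at k+1 = 1,2,3,5; ran) — a refuter re-runs it with mpmath
at k+1 = 4, 6, 7 in seconds; and (T3) itself at N = 3 by exact rational-log arithmetic of the 3×3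
Vasyunin Gram system.

NUMBERS. Q = (log 2π − γ − 1) − Σ_n m_n²/(n(n+1)) = 0.0803270395; m_1 = 2 log 2 − 1 = 0.38629, m_n ↑
1/2; κ_N = tailConst(c⋆_N)/d_N² = 0.3412 ± 0.0005 certified for 20 ≤ N ≤ 2000 (rh-li-eng), zeroth
order m_1/(1+Q) = 0.35757, predicted limit 0.33981 (prime-side constant `nbKappaPredicted`);
identity (T3) verified to 2·10⁻¹² at every N ≤ 2000 (kit j243603, 0.05 core-h).

DEFINITION REQUESTS. None: `nbRho/nbGram/nbRhs/nbFareyMean/nbStepH/nbFluct/nbQ/nbRhoH` and the leaf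
`NbTailConstIdentity` are in `Theorems/LiCoefficientsDefs.lean` (p405895); `approx`/`tailConst` are
Literature (`NymanBeurlingProofs`).

Novelty: Searches (2026-08-25): lit search --hybrid "Nyman Beurling approximation fractional part Gram matrix
tail constant sum c_k/k normal equations" (8 hits, none relevant: numerics textbooks); lit vsearch
"<the identity in prose>" (8, none relevant); lit search "Nyman Beurling Báez-Duarte minimizer
coefficients" --source local (8: arXiv:2405.06349 Gram matrices/Vasyunin sums, arXiv:2203.05030
Hardy-space orthogonality, doi:10.1016/j.aim.2006.04.003, arXiv:1805.06733, arXiv:2310.03972 — none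
states a minimiser identity); lit galaxy search "Nyman-Beurling|Baez-Duarte
criterion|Beurling-Nyman" --star all (19 rows: RH surveys/Borwein et al., Bettin–Conrey period
functions, Ivić identities for ∫{x} — no minimiser structure); lit read paper:arxiv-2405.06349
--grep 'Vasyunin|normal equation|minimi|tail' (Gram-entry formulas = BBLS Prop. 90; no tail
identity); tree: Literature.Barriers.RiemannHypothesis.NymanBeurlingObstructions docstring
(Báez-Duarte 2000 Prop 4.7: e_k = ρ_k − ρ_1/k step functions).
Nearest prior art found: BaezDuarte2000 (class 𝒞^nat spanned by the step functions e_k = ρ(1/(kx)) −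
ρ(1/x)/k, Prop. 4.7) and BaezDuarte2003 §2.2 (competitors equal −C/x on (1,∞), C = tailConst);
Vasyunin1996 / LandreauRichard2002 Thm 2.1 (closed form of the Gram matrix); arXiv:2405.06349 (2024,
Gram matrices and Vasyunin sums).
Delta: the conditional-expectation split {1/x} = h + q on the Farey partition, with ⟨ρ_{k+1}, q⟩ =
Q/(k+1) for all k, turns the first normal equation into an exact RH  [refs: 10.1016/j.aim.2006.04.003, 2405.06349, 2203.05030, 1805.06733, 2310.03972, doi:10.1016/j.aim.2006.04.003, paper:arxiv-2405.06349, BaezDuarte2000, BaezDuarte2003, Vasyunin1996, LandreauRichard2002]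

Barriers (technique_class: hilbert-space-projection, farey-partition, explicit-integrals): - technique_class: hilbert-space-projection, farey-partition, explicit-integrals
- Literature.Barriers.RiemannHypothesis.NymanBeurlingObstructions: outside — the route makes no
convergence or rate claim (d_N → 0, ≫ 1/√log N); it is an exact identity for each fixed N,
consistent with BDBLS2000/Burnol2002 (indeed it quantifies the tail share of d_N²).
- Literature.Barriers.RiemannHypothesis.MollifierLimitations: outside — no mollified moment or
length-θ asymptotics is used; finite-N linear algebra + integrals on (0,1].
- Literature.Barriers.RiemannHypothesis.BoundedFluctuationCounting / LindelofBacklund /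
GramRosserFailures: not in this route's class (no zeros, no S(t), no ζ-size input).
- Negatives index: `ledger negatives --problem RiemannHypothesis` re-read 2026-08-25T21:35Z lists 2
refuted statements (stmt-RiemannHypothesis-16980 Jacobi-symbol sine-sum positivity;
stmt-RiemannHypothesis-2575 de Bruijn universal-factor real-zeros) — none about Nyman–Beurling
minimisers or fractional-part integrals; nothing to steer around.

History (route lifecycle, newest last):
- 2026-08-26T11:47:28Z · CLOSED proved — proved:Summit.RiemannHypothesis.RiemannHypothesis.Theorems.NbTheory.nbTailConstIdentity_holds (operator:999:2546756)

sub-problem: RiemannHypothesis · status: closed(proved) · opened planner-rh-li-theory-g4-0 2026-08-25T22:07:11Z · rev 1 · ledger route-RiemannHypothesis-NymanBeurlingTail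
GENERATED by the gate from the ledger (D-0016/17). Provers cite these decls: `theorem foo : Summit.RiemannHypothesis.RiemannHypothesis.Theses.NymanBeurlingTail.<Decl> := …` in Summits/RiemannHypothesis/RiemannHypothesis/Theorems/<Name>.lean.
-/

namespace Summit.RiemannHypothesis.RiemannHypothesis.Theses.NymanBeurlingTail

open scoped BigOperators Topology Manifold Classical MeasureTheory ProbabilityTheory Matrix InnerProductSpace ComplexConjugate ContinuousMap
open Filter Set Function TopologicalSpace MeasureTheory

attribute [summit_statement] _root_.Summit.RiemannHypothesis
attribute [summit_statement] _root_.Summit.RiemannHypothesis.RiemannHypothesis.Theorems.NbTheory.NbTailConstIdentity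

open Summit

/-- item stmt-RiemannHypothesis-19682 · crux · rank 2 · closed · proved by Summit.RiemannHypothesis.RiemannHypothesis.Theorems.NbTheory.nbKeyOrthogonality_holds @ 7c59fe010a3b (prover) · by planner
why it might fail: derived this week, float-checked only (k+1 = 1,2,3,5 to 1e-9, g3 ortho_check.py; (T3) to 2e-12 for N ≤ 2000, j243603); false iff the step-function claim ρ_{k+1} − ρ_1/(k+1) ∈ span{1_{I_n}} failed on positive measure — a standard floor identity, so the live risk is a convention slip in nbFluct/nbQ.
sources: BaezDuarte2000, BaezDuarte2003, Vasyunin1996, folder:ortho_check.py, kit:j243603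
[crux] (K1) KEY ORTHOGONALITY: for every `k ≥ 0`, `∫_{(0,1]} ρ_{k+1}(x) q(x) dx = Q/(k+1)` with
`ρ_{k+1}(x) = {1/((k+1)x)}`, `q = {1/x} − h`, `Q = ∫_{(0,1]} q²` — because `ρ_{k+1} = ρ_1/(k+1) +
{⌊1/x⌋/(k+1)}` on `(0,1]` (an `I_n`-step function), `q ⊥` bounded steps, and `⟨ρ_1, q⟩ = ⟨h + q, q⟩
= Q`. [deps: NbFluctStepOrthogonal] [difficulty: M] -/
@[route_item "route-RiemannHypothesis-NymanBeurlingTail", crux (experiment := "instrument: kit jobs cited as sources kit:j243603") (source := "ledger wanted_by.sources on stmt-RiemannHypothesis-19682, 2026-09-01")]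
def NbKeyOrthogonality : Prop :=
  ∀ k : ℕ, ∫ x in Set.Ioc (0 : ℝ) 1, Summit.RiemannHypothesis.RiemannHypothesis.Theorems.NbTheory.nbRho k x * Summit.RiemannHypothesis.RiemannHypothesis.Theorems.NbTheory.nbFluct x = Summit.RiemannHypothesis.RiemannHypothesis.Theorems.NbTheory.nbQ / ((k : ℝ) + 1)

/-- `NbKeyOrthogonality` holds: proved by `Summit.RiemannHypothesis.RiemannHypothesis.Theorems.NbTheory.nbKeyOrthogonality_holds` @ 7c59fe010a3b. -/
theorem NbKeyOrthogonality_holds : NbKeyOrthogonality := _root_.Summit.RiemannHypothesis.RiemannHypothesis.Theorems.NbTheory.nbKeyOrthogonality_holds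

/-- item stmt-RiemannHypothesis-19683 · crux · rank 3 · closed · proved by Summit.RiemannHypothesis.RiemannHypothesis.Theorems.NbTheory.nbFirstNormalEquation_holds @ 7c59fe010a3b (prover) · by planner
why it might fail: only if `nbGram 0 j = ∫_{(0,∞)} ρ_1 ρ_{j+1}` were a junk Bochner value (non-integrable integrand) — it is not: the integrand is ≤ 1 on (0,1] and = 1/((j+1)x²) on (1,∞); a wrong normalisation of `nbRhs`/`nbGram` (e.g. Gram on (0,1) instead of (0,∞)) would shift the identity by exactly tailConst.
sources: BaezDuarte2003, LandreauRichard2002, Vasyunin1996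
[crux] (K2) the FIRST normal equation on Nyman's interval: if `c` solves `G c = b` (`N ≥ 1`) then
`∫_{(0,1]} (χ − f_c)(x)·{1/x} dx = tailConst(c)` — row `0` of `G` splits as `G_{0j} = G⁰_{0j} +
1/(j+1)` (on `(1,∞)`, `ρ_1 = 1/x`, `ρ_{j+1} = 1/((j+1)x)`), so `⟨χ − f_c, ρ_1⟩_{(0,∞)} = 0` reads
`⟨χ − f_c, ρ_1⟩_{(0,1]} − tailConst(c) = 0`. [difficulty: M] -/
@[route_item "route-RiemannHypothesis-NymanBeurlingTail", crux]
def NbFirstNormalEquation : Prop :=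
  ∀ (N : ℕ) (cs : Fin N → ℝ), 1 ≤ N → (∀ k : Fin N, ∑ j : Fin N, Summit.RiemannHypothesis.RiemannHypothesis.Theorems.NbTheory.nbGram k j * cs j = Summit.RiemannHypothesis.RiemannHypothesis.Theorems.NbTheory.nbRhs k) → ∫ x in Set.Ioc (0 : ℝ) 1, Literature.NumberTheory.LFunctions.BaezDuarteOnlyIf.approx cs x * Int.fract (1 / x) = Literature.NumberTheory.LFunctions.BaezDuarteOnlyIf.tailConst cs

/-- `NbFirstNormalEquation` holds: proved by `Summit.RiemannHypothesis.RiemannHypothesis.Theorems.NbTheory.nbFirstNormalEquation_holds` @ 7c59fe010a3b. -/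
theorem NbFirstNormalEquation_holds : NbFirstNormalEquation := _root_.Summit.RiemannHypothesis.RiemannHypothesis.Theorems.NbTheory.nbFirstNormalEquation_holds

/-- item stmt-RiemannHypothesis-19684 · support · rank 9 · closed · proved by Summit.RiemannHypothesis.RiemannHypothesis.Theorems.NbTheory.nbFluctStepOrthogonal_proof @ 2224506e5561 (prover) · by planner
why it might fail: routine (dominated exchange of Σ_n and ∫ over the partition; `∫_{I_n} {1/x} dx = log(1+1/n) − 1/(n+1) = m_n |I_n|`).
sources: BaezDuarte2000, folklore
[support] (K3) `q = {1/x} − h` is orthogonal on `(0,1]` to every bounded `I_n`-step function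
`w(⌊1/x⌋)` (mean zero of `q` on each `I_n` by the definition of `m_n = n(n+1)log(1+1/n) − n`, summed
over the countable partition with `|q| ≤ 2`). [difficulty: M] -/
@[route_item "route-RiemannHypothesis-NymanBeurlingTail", crux]
def NbFluctStepOrthogonal : Prop :=
  ∀ w : ℕ → ℝ, (∃ B : ℝ, ∀ n, |w n| ≤ B) → ∫ x in Set.Ioc (0 : ℝ) 1, w ⌊1 / x⌋₊ * Summit.RiemannHypothesis.RiemannHypothesis.Theorems.NbTheory.nbFluct x = 0

-- `NbFluctStepOrthogonal` holds: proved by `Summit.RiemannHypothesis.RiemannHypothesis.Theorems.NbTheory.nbFluctStepOrthogonal_proof` @ 2224506e5561 (its module imports this route file, so no `_holds` link can be stated here).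

/-- item stmt-RiemannHypothesis-19685 · support · rank 9 · closed · proved by Summit.RiemannHypothesis.RiemannHypothesis.Theorems.NbTheory.nbCondExpIntegral_proof @ 2224506e5561 (prover) · by planner
why it might fail: routine (telescoping `log(N+1) − H_{N+1} + 1 → 1 − γ` against Mathlib's `Real.eulerMascheroniConstant` as the limit of `H_n − log n`).
sources: folklore, Mathlib:Real.tendsto_harmonic_sub_log
[support] (K4) `∫_{(0,1]} h = Σ_n m_n |I_n| = Σ_n (log(1+1/n) − 1/(n+1)) = 1 − γ` (= `∫_0^1 {1/x}
dx`, de la Vallée Poussin). [difficulty: S] -/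
@[route_item "route-RiemannHypothesis-NymanBeurlingTail", crux]
def NbCondExpIntegral : Prop :=
  ∫ x in Set.Ioc (0 : ℝ) 1, Summit.RiemannHypothesis.RiemannHypothesis.Theorems.NbTheory.nbStepH x = 1 - Real.eulerMascheroniConstant

-- `NbCondExpIntegral` holds: proved by `Summit.RiemannHypothesis.RiemannHypothesis.Theorems.NbTheory.nbCondExpIntegral_proof` @ 2224506e5561 (its module imports this route file, so no `_holds` link can be stated here).

/-- item stmt-RiemannHypothesis-19686 · assembly · rank 1 · closed · proved by Summit.RiemannHypothesis.RiemannHypothesis.Theorems.NbTheory.nbAssembly_proof @ 9713dcdd4f16 (prover) · by planner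
sources: BaezDuarte2003, Vasyunin1996
[assembly] NbKeyOrthogonality → NbFirstNormalEquation → NbFluctStepOrthogonal → NbCondExpIntegral →
the rung leaf NbTailConstIdentity (provable now; proof supplied in
HOME/theory/route/nb/SketchNB.lean `assembly_proof`). -/
@[route_item "route-RiemannHypothesis-NymanBeurlingTail", crux]
def Assembly : Prop :=
  NbKeyOrthogonality → NbFirstNormalEquation → NbFluctStepOrthogonal → NbCondExpIntegral → Summit.RiemannHypothesis.RiemannHypothesis.Theorems.NbTheory.NbTailConstIdentity

-- `Assembly` holds: proved by `Summit.RiemannHypothesis.RiemannHypothesis.Theorems.NbTheory.nbAssembly_proof` @ 9713dcdd4f16 (its module imports this route file, so no `_holds` link can be stated here).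

/-! D-0027 §2.1 — DECIDING THEOREM (planner-authored via `route open/edit --closes-file`; by planner-rh-li-theory-g4-0 2026-08-25T22:07:11Z) — ARCHIVED: route closed (proved) 2026-08-26T11:47:28Z; kept so importers keep building:
its hypotheses are this route's items and its conclusion the registered leaf `Summit.RiemannHypothesis.RiemannHypothesis.Theorems.NbTheory.NbTailConstIdentity` (rung L-P(P2), D-0061) (glue_lint), and it elaborates with this file. -/

-- glue-nb.lean — DECIDING THEOREM of route NymanBeurlingTail (D-0027 §2.1; R5 shape, D-0061: concludes the RUNG LEAF
-- L-P(P2) `Summit.RiemannHypothesis.RiemannHypothesis.Theorems.NbTheory.NbTailConstIdentity` BY NAME).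
-- Hypotheses = the two crux decls + the two support decls + the (provable-now) Assembly item; every binder is consumed.
@[closes "route-RiemannHypothesis-NymanBeurlingTail"] theorem closes (h2 : NbKeyOrthogonality) (h3 : NbFirstNormalEquation) (h4 : NbFluctStepOrthogonal)
    (h5 : NbCondExpIntegral) (hA : Assembly) :
    Summit.RiemannHypothesis.RiemannHypothesis.Theorems.NbTheory.NbTailConstIdentity :=
  hA h2 h3 h4 h5

end Summit.RiemannHypothesis.RiemannHypothesis.Theses.NymanBeurlingTail
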